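import Summits.CriticalPhenomena.SAWScalingLimit.Theses.SAWDefectDecoherence
import Summits.CriticalPhenomena.SAWScalingLimit.Cruxes.MassRatio.Disproof

/-!
# Sketch — crux-ideate round 2, ideator 5, crux `MassRatio` (stmt-CriticalPhenomena-8550)

First lemmas of the two idea cards of this seat (statements only; `sorry` where a proof is
not yet written — the cards say which are provable now):

* `MirrorDoubling` — card `mirror-doubling-endpoint-restriction`:
  the exact row reflection `rowReflect m` of the honeycomb through the door line below row `m`
  (the rows clause makes `Λ_δ ∩ B(b,ρ)` an exact half-lattice, so the mirror image glues in),
  the doubled families `IsDoubling`, the two surgery-free statements `EndpointRestriction t`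
  (one-sided restriction at the endpoint) and `InteriorHarnackInf s` (the bulk point `b_δ ∈ Λ⁺`
  is no cold spot), and the composition `massRatio_of` :
  `InteriorHarnackInf s → EndpointRestriction (3/4 - s) → MassRatio`.
* `FloatingRenewal` — supports the evidence note `NOTE-r2-ideator5.md` (budget repricing, NOT a
  card): the exact renewal-count identity `renewal_identity` / `floating_identity` (sum over
  nested half-discs of the single-crossing products = walks weighted by their number of
  single-crossed rims; toy-verified to 1e-16), and why its rigorous use is circular for this crux.
-/

namespace Summit.CriticalPhenomena.SAWScalingLimit.Cruxes.MassRatio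

open Literature.Probability.LatticeModels Literature.Probability.RandomPlanarGeometry
open Literature.Probability.RandomPlanarGeometry.SAW

noncomputable section

/-- The critical two-point mass `Z_Λ(a → z) = |F_{x_c,0}(z)| = Σ_{γ ⊂ Λ : a → z} x_c^{ℓ(γ)}`. -/
def Z (Λ : Finset HexVertex) (a z : Sym2 HexVertex) : ℝ :=
  ‖hexParafermionicObservable Λ a hexCriticalFugacity 0 z‖

/-- The hypothesis frame of `SAWDefectDecoherence.MassRatio`, verbatim, packaged as one
predicate (flat half-plane piece and rows clause at `b = D.pt 1`, admissible family,
exhaustion, `a_δ → a`, `b_δ → b`). -/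
def Frame (D : DobrushinDomain) (ρ : ℝ) (Λ : ℝ → Finset HexVertex) (m : ℝ → ℤ)
    (a b : ℝ → Sym2 HexVertex) : Prop :=
  0 < ρ ∧
  D.carrier ∩ Metric.ball (D.pt 1) ρ = {z : ℂ | (D.pt 1).im < z.im} ∩ Metric.ball (D.pt 1) ρ ∧
  (∀ᶠ δ : ℝ in nhdsWithin 0 (Set.Ioi 0),
    hexDomainSimplyConnected (Λ δ) ∧ a δ ∈ hexDomainBoundary (Λ δ) ∧
    b δ ∈ hexDomainBoundary (Λ δ) ∧ Nonempty (HexMidEdgeSAW (Λ δ) (a δ) (b δ)) ∧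
    (hexGraph.induce ((Λ δ : Finset HexVertex) : Set HexVertex)).Preconnected ∧
    (∀ v ∈ Λ δ, (δ : ℂ) * hexCenter v ∈ D.carrier) ∧
    (∀ v : HexVertex, (δ : ℂ) * hexCenter v ∈ Metric.ball (D.pt 1) ρ →
      (v ∈ Λ δ ↔ m δ ≤ v.1 1))) ∧
  (∀ K : Set ℂ, IsCompact K → K ⊆ D.carrier → ∀ᶠ δ : ℝ in nhdsWithin 0 (Set.Ioi 0),
    ∀ v : HexVertex, (δ : ℂ) * hexCenter v ∈ K → v ∈ Λ δ) ∧
  Filter.Tendsto (fun δ : ℝ => (δ : ℂ) * hexMidpoint (a δ)) (nhdsWithin 0 (Set.Ioi 0))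
    (nhds (D.pt 0)) ∧
  Filter.Tendsto (fun δ : ℝ => (δ : ℂ) * hexMidpoint (b δ)) (nhdsWithin 0 (Set.Ioi 0))
    (nhds (D.pt 1))

namespace MirrorDoubling

/-- The row reflection of the honeycomb through the door line just below row `m`
(brick coordinates `(row, pos) ↦ (2m - 1 - row, pos)` with `row = v.1 1`,
`pos = 2 v.1 0 + v.1 1 + v.2`): a graph automorphism of `hexGraph`, an isometry of the
embedding `hexCenter` (reflection in the horizontal line `Im z = √3 m / 2`), an involution, and
it FIXES every door edge `{(x,m,0),(x,m-1,1)}` — the boundary mid-edges of the exact half-lattice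
`{row ≥ m}`, among them `b_δ`. -/
def rowReflect (m : ℤ) (v : HexVertex) : HexVertex :=
  (![v.1 0 + v.1 1 + ((v.2 : ℕ) : ℤ) - m, 2 * m - 1 - v.1 1], if v.2 = 0 then 1 else 0)

theorem row_rowReflect (m : ℤ) (v : HexVertex) :
    Disproof.row (rowReflect m v) = 2 * m - 1 - Disproof.row v := by
  simp [Disproof.row, rowReflect]

theorem pos_rowReflect (m : ℤ) (v : HexVertex) :
    Disproof.pos (rowReflect m v) = Disproof.pos v := by
  obtain ⟨x, k⟩ := v
  have hk : k = 0 ∨ k = 1 := by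
    rcases k with ⟨k, hk⟩
    have : k = 0 ∨ k = 1 := by omega
    rcases this with rfl | rfl
    · exact Or.inl rfl
    · exact Or.inr rfl
  rcases hk with rfl | rfl <;> simp [Disproof.pos, rowReflect] <;> ring

/-- `rowReflect` in brick coordinates: `(row, pos) ↦ (2m - 1 - row, pos)`. -/
theorem rowReflect_eq_bv (m : ℤ) (v : HexVertex) :
    rowReflect m v = Disproof.bv (2 * m - 1 - Disproof.row v) (Disproof.pos v) := by
  rw [← row_rowReflect m v, ← pos_rowReflect m v, Disproof.bv_row_pos]

/-- `rowReflect m` is an involution. -/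
theorem rowReflect_rowReflect (m : ℤ) (v : HexVertex) : rowReflect m (rowReflect m v) = v := by
  rw [rowReflect_eq_bv, row_rowReflect, pos_rowReflect,
    show 2 * m - 1 - (2 * m - 1 - Disproof.row v) = Disproof.row v by ring, Disproof.bv_row_pos]

/-- `rowReflect m` is a graph automorphism of the honeycomb lattice. -/
theorem adj_rowReflect (m : ℤ) (u v : HexVertex) :
    hexGraph.Adj (rowReflect m u) (rowReflect m v) ↔ hexGraph.Adj u v := by
  rw [Disproof.adj_iff, Disproof.adj_iff, row_rowReflect, row_rowReflect, pos_rowReflect,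
    pos_rowReflect]
  constructor
  · rintro (⟨h1, h2⟩ | ⟨h1, h2, h3⟩ | ⟨h1, h2, h3⟩)
    · exact Or.inl ⟨by omega, h2⟩
    · exact Or.inr (Or.inr ⟨h1, by omega, by omega⟩)
    · exact Or.inr (Or.inl ⟨h1, by omega, by omega⟩)
  · rintro (⟨h1, h2⟩ | ⟨h1, h2, h3⟩ | ⟨h1, h2, h3⟩)
    · exact Or.inl ⟨by omega, h2⟩
    · exact Or.inr (Or.inr ⟨h1, by omega, by omega⟩)
    · exact Or.inr (Or.inl ⟨h1, by omega, by omega⟩)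

/-- `rowReflect m` realises the reflection in the horizontal line `Im z = √3 m / 2` on the
embedded centres: real parts are preserved ... -/
theorem re_center_rowReflect (m : ℤ) (v : HexVertex) :
    (hexCenter (rowReflect m v)).re = (hexCenter v).re := by
  rw [Disproof.hexCenter_re, Disproof.hexCenter_re, pos_rowReflect]

/-- ... and imaginary parts are reflected: `Im c(Rv) + Im c(v) = √3 · m`. -/
theorem im_center_rowReflect (m : ℤ) (v : HexVertex) :
    (hexCenter (rowReflect m v)).im + (hexCenter v).im = Real.sqrt 3 * m := by
  rw [Disproof.hexCenter_im, Disproof.hexCenter_im, row_rowReflect]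
  obtain ⟨x, k⟩ := v
  have hk : k = 0 ∨ k = 1 := by
    rcases k with ⟨k, hk⟩
    have : k = 0 ∨ k = 1 := by omega
    rcases this with rfl | rfl
    · exact Or.inl rfl
    · exact Or.inr rfl
  rcases hk with rfl | rfl <;> simp [rowReflect, Disproof.row] <;> ring

/-- `rowReflect m` fixes every door edge `{v, rowReflect m v}` (as an unordered pair). -/
theorem rowReflect_door (m : ℤ) (v : HexVertex) :
    Sym2.map (rowReflect m) s(v, rowReflect m v) = s(v, rowReflect m v) := by
  rw [Sym2.map_pair_eq, rowReflect_rowReflect, Sym2.eq_swap]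

/-- The door edge at a row-`m` vertex with `v.2 = 0` is a honeycomb edge (vertical edge down). -/
theorem adj_door (m : ℤ) (v : HexVertex) (hr : v.1 1 = m) (hk : v.2 = 0) :
    hexGraph.Adj v (rowReflect m v) := by
  rw [Disproof.adj_iff, row_rowReflect, pos_rowReflect]
  refine Or.inr (Or.inl ⟨rfl, ?_, ?_⟩)
  · simp only [Disproof.row, hr]; ring
  · obtain ⟨x, k⟩ := v
    simp only at hk hr
    subst hk
    simp [Disproof.pos, Disproof.row, hr]

/-- The mirror-doubled domain: `Λ` together with the reflection of its part `S` inside the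
ball at `b` (in the frame, `S = {v ∈ Λ_δ : δ c_v ∈ B(b, ρ')}` is the exact upper half-lattice
ball, and the union is the full lattice ball glued to `Λ` along the door line; `b_δ` becomes an
interior mid-edge at depth `ρ'`). -/
def mirrorDouble (m : ℤ) (S Λ : Finset HexVertex) : Finset HexVertex :=
  Λ ∪ (Λ ∩ S).image (rowReflect m)

/-- `Λ⁺ = Λp` is a doubling of the admissible family at `b` at scale `ρ'`: eventually it
contains `Λ_δ`, adds only vertices whose scaled centres lie in the ball `B(b, ρ')` (hence, by
the rows clause, only below the door line), and contains the full lattice ball of radius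
`ρ'/2` about `b`. The exact mirror `mirrorDouble (m δ) S (Λ δ)` is one; by monotonicity of `Z`
in the domain the statements below for all doublings reduce to the maximal one. -/
def IsDoubling (D : DobrushinDomain) (ρ' : ℝ) (Λ Λp : ℝ → Finset HexVertex) : Prop :=
  ∀ᶠ δ : ℝ in nhdsWithin 0 (Set.Ioi 0),
    Λ δ ⊆ Λp δ ∧
    (∀ v ∈ Λp δ, v ∉ Λ δ → (δ : ℂ) * hexCenter v ∈ Metric.ball (D.pt 1) ρ') ∧
    (∀ v : HexVertex, (δ : ℂ) * hexCenter v ∈ Metric.ball (D.pt 1) (ρ' / 2) → v ∈ Λp δ)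

/-- ONE-SIDED RESTRICTION AT THE ENDPOINT (exponent `t`): the walks from the far root `a_δ`
to the deep bulk mid-edge `b_δ` of the doubled domain that avoid the phantom lower half-ball —
i.e. stay in `Λ_δ` — carry at least a `δ^t` fraction of the mass:
`Z_{Λ_δ}(a_δ → b_δ) ≥ c δ^t Z_{Λ⁺_δ}(a_δ → b_δ)` eventually. Predicted exponent
`h_b - x_1 = 25/48`; the card needs it at `t = 3/4 - s`. No walk is decomposed. -/
def EndpointRestriction (t : ℝ) : Prop :=
  ∀ (D : DobrushinDomain) (ρ : ℝ) (Λ : ℝ → Finset HexVertex) (m : ℝ → ℤ)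
    (a b : ℝ → Sym2 HexVertex), Frame D ρ Λ m a b →
    ∀ (ρ' : ℝ) (Λp : ℝ → Finset HexVertex), 0 < ρ' → ρ' < ρ → IsDoubling D ρ' Λ Λp →
      ∃ c : ℝ, 0 < c ∧ ∀ᶠ δ : ℝ in nhdsWithin 0 (Set.Ioi 0),
        c * δ ^ t * Z (Λp δ) (a δ) (b δ) ≤ Z (Λ δ) (a δ) (b δ)

/-- INTERIOR HARNACK, infimum form (exponent `s`): in the doubled domain the (now bulk) point
`b_δ` is no cold spot of the rooted two-point function — the averaged bulk mass over any
compact `K ⊂ Ω` is at most `C δ^{-s}` times the mass at `b_δ`: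
`δ² Σ_{e ∈ K} Z_{Λ⁺_δ}(a_δ → e) ≤ C δ^{-s} Z_{Λ⁺_δ}(a_δ → b_δ)`. Predicted exponent `0`
(both sides `≍ δ^{h_b + x_1}` times a positive continuous profile). Phase-free, same root, same
domain, different bulk endpoints; no walk is decomposed. -/
def InteriorHarnackInf (s : ℝ) : Prop :=
  ∀ (D : DobrushinDomain) (ρ : ℝ) (Λ : ℝ → Finset HexVertex) (m : ℝ → ℤ)
    (a b : ℝ → Sym2 HexVertex), Frame D ρ Λ m a b →
    ∀ (ρ' : ℝ) (Λp : ℝ → Finset HexVertex), 0 < ρ' → ρ' < ρ → IsDoubling D ρ' Λ Λp →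
      ∀ K : Set ℂ, IsCompact K → K ⊆ D.carrier → ∃ C : ℝ, ∀ᶠ δ : ℝ in nhdsWithin 0 (Set.Ioi 0),
        δ ^ 2 * (∑ᶠ e ∈ {e : Sym2 HexVertex | e ∈ hexDomainMidEdges (Λ δ) ∧
            (δ : ℂ) * hexMidpoint e ∈ K}, Z (Λp δ) (a δ) e)
          ≤ C * δ ^ (-s) * Z (Λp δ) (a δ) (b δ)

/-- Monotonicity of the critical two-point mass in the domain (walks of `Λ` are walks of
`Λ' ⊇ Λ`, weights `x_c^ℓ ≥ 0`): provable now. -/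
theorem Z_mono {Λ Λ' : Finset HexVertex} (h : Λ ⊆ Λ') (a z : Sym2 HexVertex) :
    Z Λ a z ≤ Z Λ' a z := by
  classical
  have hx : (0 : ℝ) ≤ hexCriticalFugacity := by unfold hexCriticalFugacity; positivity
  unfold Z
  rw [Disproof.norm_Z_eq_sum _ _ _ hx, Disproof.norm_Z_eq_sum _ _ _ hx]
  let lift : HexMidEdgeSAW Λ a z → HexMidEdgeSAW Λ' a z := fun γ =>
    { verts := γ.verts
      subset := fun v hv => h (γ.subset v hv)
      nodup := γ.nodup
      isChain := γ.isChain
      head_mem := γ.head_mem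
      getLast_mem := γ.getLast_mem
      eq_of_nil := γ.eq_of_nil
      edges_nodup := γ.edges_nodup
      fst_mem := by
        obtain ⟨he, v, hv, hvΛ⟩ := γ.fst_mem
        exact ⟨he, v, hv, h hvΛ⟩ }
  have hinj : Function.Injective lift := by
    intro γ γ' hγ
    have hv : (lift γ).verts = (lift γ').verts := by rw [hγ]
    exact HexMidEdgeSAW.ext hv
  calc ∑ γ : HexMidEdgeSAW Λ a z, hexCriticalFugacity ^ γ.length
      = ∑ γ : HexMidEdgeSAW Λ a z, hexCriticalFugacity ^ (lift γ).length :=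
        Finset.sum_congr rfl fun γ _ => rfl
    _ = ∑ γ' ∈ (Finset.univ : Finset (HexMidEdgeSAW Λ a z)).image lift,
          hexCriticalFugacity ^ γ'.length := by
        rw [Finset.sum_image fun γ _ γ' _ hγ => hinj hγ]
    _ ≤ ∑ γ' : HexMidEdgeSAW Λ' a z, hexCriticalFugacity ^ γ'.length :=
        Finset.sum_le_univ_sum_of_nonneg fun γ' => pow_nonneg hx _

/-- Monotonicity of finite sums over a finite set of mid-edges. -/
theorem finsum_mem_mono {S : Set (Sym2 HexVertex)} (hS : S.Finite) {f g : Sym2 HexVertex → ℝ}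
    (h : ∀ e ∈ S, f e ≤ g e) : ∑ᶠ e ∈ S, f e ≤ ∑ᶠ e ∈ S, g e := by
  rw [finsum_mem_eq_finite_toFinset_sum f hS, finsum_mem_eq_finite_toFinset_sum g hS]
  exact Finset.sum_le_sum fun e he => h e (hS.mem_toFinset.1 he)

/-- Nonnegativity of such sums. -/
theorem finsum_mem_nonneg' {S : Set (Sym2 HexVertex)} (hS : S.Finite) {f : Sym2 HexVertex → ℝ}
    (h : ∀ e ∈ S, 0 ≤ f e) : 0 ≤ ∑ᶠ e ∈ S, f e := by
  rw [finsum_mem_eq_finite_toFinset_sum f hS]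
  exact Finset.sum_nonneg fun e he => h e (hS.mem_toFinset.1 he)

/-- For `δ > 0` only finitely many honeycomb vertices have their scaled centre in a given ball
(brick coordinates are bounded there). -/
theorem finite_scaled_ball (δ : ℝ) (hδ : 0 < δ) (z : ℂ) (R : ℝ) :
    {v : HexVertex | (δ : ℂ) * hexCenter v ∈ Metric.ball z R}.Finite := by
  classical
  set M : ℝ := ‖z‖ + |R| with hM
  have hM0 : 0 ≤ M := by positivity
  have hh := Disproof.hgt_pos
  obtain ⟨N, hN⟩ : ∃ N : ℕ, 2 * M / δ + M / (δ * Disproof.hgt) + 2 ≤ N := exists_nat_ge _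
  have hN1 : 2 * M / δ + 1 ≤ N := by
    have : 0 ≤ M / (δ * Disproof.hgt) := by positivity
    linarith
  have hN2 : M / (δ * Disproof.hgt) + 1 ≤ N := by
    have : 0 ≤ 2 * M / δ := by positivity
    linarith
  refine Set.Finite.subset (((Finset.Icc (-(N : ℤ)) N) ×ˢ (Finset.Icc (-(N : ℤ)) N)).image
    (fun rp : ℤ × ℤ => Disproof.bv rp.1 rp.2)).finite_toSet ?_
  intro v hv
  simp only [Set.mem_setOf_eq, Metric.mem_ball] at hv
  have hnorm : ‖(δ : ℂ) * hexCenter v‖ < M := by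
    have h1 : ‖(δ : ℂ) * hexCenter v‖ ≤ ‖(δ : ℂ) * hexCenter v - z‖ + ‖z‖ := by
      have := norm_add_le ((δ : ℂ) * hexCenter v - z) z
      simpa using this
    have h2 : ‖(δ : ℂ) * hexCenter v - z‖ < R := by rwa [← dist_eq_norm]
    have h3 : R ≤ |R| := le_abs_self R
    linarith
  have hre : |((δ : ℂ) * hexCenter v).re| < M :=
    lt_of_le_of_lt (Complex.abs_re_le_norm _) hnorm
  have him : |((δ : ℂ) * hexCenter v).im| < M :=
    lt_of_le_of_lt (Complex.abs_im_le_norm _) hnorm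
  rw [Disproof.re_scaled] at hre
  have him1 := Disproof.im_scaled_ge δ hδ.le v
  have him2 := Disproof.im_scaled_le δ hδ.le v
  rw [abs_lt] at hre him
  -- bounds on pos v
  have hp1 : ((Disproof.pos v : ℝ)) ≤ N := by
    have : δ * ((Disproof.pos v : ℝ) + 1) < 2 * M := by linarith [hre.2]
    have : (Disproof.pos v : ℝ) + 1 < 2 * M / δ := by
      rw [lt_div_iff₀ hδ]; linarith
    linarith
  have hp2 : (-(N : ℝ)) ≤ (Disproof.pos v : ℝ) := by
    have : -(2 * M) < δ * ((Disproof.pos v : ℝ) + 1) := by linarith [hre.1]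
    have : -(2 * M / δ) < (Disproof.pos v : ℝ) + 1 := by
      rw [neg_lt, lt_div_iff₀ hδ]; linarith
    linarith
  -- bounds on row v
  have hδh : 0 < δ * Disproof.hgt := mul_pos hδ hh
  have hr1 : ((Disproof.row v : ℝ)) ≤ N := by
    have : δ * Disproof.hgt * ((Disproof.row v : ℝ) + 1 / 3) < M := by linarith [him.2]
    have : (Disproof.row v : ℝ) + 1 / 3 < M / (δ * Disproof.hgt) := by
      rw [lt_div_iff₀ hδh]; linarith
    linarith
  have hr2 : (-(N : ℝ)) ≤ (Disproof.row v : ℝ) := by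
    have : -M < δ * Disproof.hgt * ((Disproof.row v : ℝ) + 2 / 3) := by linarith [him.1]
    have : -(M / (δ * Disproof.hgt)) < (Disproof.row v : ℝ) + 2 / 3 := by
      rw [neg_lt, lt_div_iff₀ hδh]; linarith
    linarith
  simp only [Finset.coe_image, Finset.coe_product, Finset.coe_Icc, Set.mem_image, Set.mem_prod,
    Set.mem_Icc, Prod.exists]
  refine ⟨Disproof.row v, Disproof.pos v, ⟨⟨?_, ?_⟩, ?_, ?_⟩, Disproof.bv_row_pos v⟩
  · exact_mod_cast hr2
  · exact_mod_cast hr1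
  · exact_mod_cast hp2
  · exact_mod_cast hp1

/-- A doubling exists for every frame (take `Λ_δ ∪ {v : δ c_v ∈ B(b, ρ'), row < m δ}`, a
finite set): provable now. -/
theorem exists_doubling (D : DobrushinDomain) (ρ : ℝ) (Λ : ℝ → Finset HexVertex) (m : ℝ → ℤ)
    (a b : ℝ → Sym2 HexVertex) (_hF : Frame D ρ Λ m a b) (ρ' : ℝ) (h0 : 0 < ρ') (_h1 : ρ' < ρ) :
    ∃ Λp : ℝ → Finset HexVertex, IsDoubling D ρ' Λ Λp := by
  classical
  -- the set of vertices whose scaled centre lies in the ball B(b, ρ') is finite for δ > 0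
  have hfin : ∀ δ : ℝ, 0 < δ →
      {v : HexVertex | (δ : ℂ) * hexCenter v ∈ Metric.ball (D.pt 1) ρ'}.Finite :=
    fun δ hδ => finite_scaled_ball δ hδ (D.pt 1) ρ'
  refine ⟨fun δ => if hδ : 0 < δ then Λ δ ∪ (hfin δ hδ).toFinset else Λ δ, ?_⟩
  have hpos : ∀ᶠ δ : ℝ in nhdsWithin 0 (Set.Ioi 0), 0 < δ := eventually_mem_nhdsWithin
  filter_upwards [hpos] with δ hδ
  simp only [hδ, ↓reduceDIte]
  refine ⟨Finset.subset_union_left, ?_, ?_⟩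
  · intro v hv hvΛ
    rcases Finset.mem_union.1 hv with h | h
    · exact (hvΛ h).elim
    · exact (hfin δ hδ).mem_toFinset.1 h
  · intro v hv
    apply Finset.mem_union_right
    rw [Set.Finite.mem_toFinset]
    exact Metric.ball_subset_ball (by linarith) hv

/-- FIRST LEMMA of card `mirror-doubling-endpoint-restriction` (glue, provable now from
`Z_mono` and `exists_doubling`): the two surgery-free statements compose to the crux BY NAME.
`δ²Σ_K Z_Λ ≤ δ²Σ_K Z_{Λ⁺} ≤ C δ^{-s} Z_{Λ⁺}(b_δ) ≤ (C/c) δ^{-s-(3/4-s)} Z_Λ(b_δ)`.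
PROVED below (sorry-free; the exponent split `s` is free — no sign condition is needed). -/
theorem massRatio_of (s : ℝ)
    (hH : InteriorHarnackInf s) (hR : EndpointRestriction (3 / 4 - s)) :
    Theses.SAWDefectDecoherence.MassRatio := by
  intro D ρ Λ m a b Zc hρ hflat hev hexh ha hb K hK hKD
  have hF : Frame D ρ Λ m a b := ⟨hρ, hflat, hev, hexh, ha, hb⟩
  have hρ2 : (0 : ℝ) < ρ / 2 := by positivity
  have hρ2' : ρ / 2 < ρ := by linarith
  obtain ⟨Λp, hD⟩ := exists_doubling D ρ Λ m a b hF (ρ / 2) hρ2 hρ2'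
  obtain ⟨C, hC⟩ := hH D ρ Λ m a b hF (ρ / 2) Λp hρ2 hρ2' hD K hK hKD
  obtain ⟨c, hc, hcR⟩ := hR D ρ Λ m a b hF (ρ / 2) Λp hρ2 hρ2' hD
  refine ⟨max C 0 / c, ?_⟩
  have hpos : ∀ᶠ δ : ℝ in nhdsWithin 0 (Set.Ioi 0), 0 < δ := eventually_mem_nhdsWithin
  filter_upwards [hC, hcR, hD, hpos] with δ hCδ hRδ hDδ hδ
  -- the finite set of K-mid-edges of Λ_δ
  set S : Set (Sym2 HexVertex) :=
    {e : Sym2 HexVertex | e ∈ hexDomainMidEdges (Λ δ) ∧ (δ : ℂ) * hexMidpoint e ∈ K} with hSdef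
  have hSfin : S.Finite := (Disproof.hexDomainMidEdges_finite (Λ δ)).subset fun e he => he.1
  have hZc : ∀ e, ‖Zc δ e‖ = Z (Λ δ) (a δ) e := fun e => rfl
  simp only [hZc]
  -- step 1: monotonicity in the domain
  have h1 : ∑ᶠ e ∈ S, Z (Λ δ) (a δ) e ≤ ∑ᶠ e ∈ S, Z (Λp δ) (a δ) e :=
    finsum_mem_mono hSfin fun e _ => Z_mono hDδ.1 _ _
  have hδ2 : (0 : ℝ) ≤ δ ^ 2 := by positivity
  have hZp0 : 0 ≤ Z (Λp δ) (a δ) (b δ) := norm_nonneg _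
  have hZ0 : 0 ≤ Z (Λ δ) (a δ) (b δ) := norm_nonneg _
  have hrpow : (0 : ℝ) < δ ^ (-s) := Real.rpow_pos_of_pos hδ _
  have hrpow' : (0 : ℝ) < δ ^ (3 / 4 - s) := Real.rpow_pos_of_pos hδ _
  -- step 2: Harnack in the doubled domain, with a nonnegative constant
  have h2 : δ ^ 2 * ∑ᶠ e ∈ S, Z (Λp δ) (a δ) e ≤ max C 0 * δ ^ (-s) * Z (Λp δ) (a δ) (b δ) :=
    hCδ.trans (by gcongr; exact le_max_left _ _)
  -- step 3: the endpoint restriction bound, rewritten as an upper bound on Z_{Λ⁺}(b_δ)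
  have h3 : Z (Λp δ) (a δ) (b δ) ≤ Z (Λ δ) (a δ) (b δ) / (c * δ ^ (3 / 4 - s)) := by
    rw [le_div_iff₀ (mul_pos hc hrpow')]
    calc Z (Λp δ) (a δ) (b δ) * (c * δ ^ (3 / 4 - s))
        = c * δ ^ (3 / 4 - s) * Z (Λp δ) (a δ) (b δ) := by ring
      _ ≤ Z (Λ δ) (a δ) (b δ) := hRδ
  -- step 4: assemble; δ^{-s} / δ^{3/4-s} = δ^{-3/4}
  have hexp : δ ^ (-s) / δ ^ (3 / 4 - s) = δ ^ (-(3 : ℝ) / 4) := by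
    rw [← Real.rpow_sub hδ]
    congr 1; ring
  calc δ ^ 2 * ∑ᶠ e ∈ S, Z (Λ δ) (a δ) e
      ≤ δ ^ 2 * ∑ᶠ e ∈ S, Z (Λp δ) (a δ) e := by gcongr
    _ ≤ max C 0 * δ ^ (-s) * Z (Λp δ) (a δ) (b δ) := h2
    _ ≤ max C 0 * δ ^ (-s) * (Z (Λ δ) (a δ) (b δ) / (c * δ ^ (3 / 4 - s))) :=
        mul_le_mul_of_nonneg_left h3 (mul_nonneg (le_max_right _ _) hrpow.le)
    _ = max C 0 / c * (δ ^ (-s) / δ ^ (3 / 4 - s)) * Z (Λ δ) (a δ) (b δ) := by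
        field_simp
    _ = max C 0 / c * δ ^ (-(3 : ℝ) / 4) * Z (Λ δ) (a δ) (b δ) := by rw [hexp]

/-- The door edges of the frame inside the ball `B(b, ρ')`: vertical edges `{(x,m,0),(x,m-1,1)}`
(boundary mid-edges of the exact half-lattice `{row ≥ m}`) whose scaled midpoint lies in the ball. -/
def doorEdges (D : DobrushinDomain) (ρ' δ : ℝ) (m : ℤ) : Set (Sym2 HexVertex) :=
  {d | ∃ v : HexVertex, v.1 1 = m ∧ v.2 = 0 ∧ d = s(v, rowReflect m v) ∧
    (δ : ℂ) * hexMidpoint d ∈ Metric.ball (D.pt 1) ρ'}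

/-- DOOR DECOMPOSITION (provable now; rigorous upper bound, see IdeatorFiveNote §5): a walk of the
doubled domain to `b_δ` either stays in `Λ_δ` or enters the glued lower half-ball for the first
time through a door edge `d`; cutting there and dropping the mutual avoidance of the two pieces,
`Z_{Λ⁺}(a→b_δ) ≤ Z_Λ(a→b_δ) + Σ_{d door} Z_Λ(a→d) · Z_{Λ⁺}(d→b_δ)`.
(With boundary Harnack along the flat piece and `Σ_d Z_{Λ⁺}(d→b_δ) ≤ C R^{1-η₀}` this yields
`EndpointRestriction (1 - η₀)` — enough for the crux only after a re-cut of the pair to `c < 1`,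
which is why it is recorded here and not in the card.) -/
theorem door_decomposition (D : DobrushinDomain) (ρ : ℝ) (Λ : ℝ → Finset HexVertex) (m : ℝ → ℤ)
    (a b : ℝ → Sym2 HexVertex) (hF : Frame D ρ Λ m a b) (ρ' : ℝ) (h0 : 0 < ρ') (h1 : ρ' < ρ)
    (Λp : ℝ → Finset HexVertex) (hD : IsDoubling D ρ' Λ Λp) :
    ∀ᶠ δ : ℝ in nhdsWithin 0 (Set.Ioi 0),
      Z (Λp δ) (a δ) (b δ) ≤ Z (Λ δ) (a δ) (b δ) +
        ∑ᶠ d ∈ doorEdges D ρ' δ (m δ), Z (Λ δ) (a δ) d * Z (Λp δ) d (b δ) := by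
  sorry

end MirrorDoubling

namespace FloatingRenewal

/-- Number of rim crossings of the region `H` by the walk `ω`: the number of consecutive
visited vertices lying on opposite sides of `H`. -/
def crossCount (H : Finset HexVertex) {Λ : Finset HexVertex} {a z : Sym2 HexVertex}
    (ω : HexMidEdgeSAW Λ a z) : ℕ :=
  (List.zipWith (fun u w => if (u ∈ H ↔ w ∈ H) then 0 else 1) ω.verts ω.verts.tail).sum

/-- The rim of `H` inside `Λ`: mid-edges `{p, q}` with `p ∈ Λ ∖ H`, `q ∈ H`, `p ∼ q`. -/
def rim (Λ H : Finset HexVertex) : Set (Sym2 HexVertex) :=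
  {w | ∃ p q : HexVertex, w = s(p, q) ∧ p ∈ Λ ∧ p ∉ H ∧ q ∈ H ∧ hexGraph.Adj p q}

/-- RENEWAL-COUNT IDENTITY, one region (provable now: the bijection "cut at the unique rim
crossing"): for `H ⊆ Λ` containing the inner vertex of `b` and missing both vertices of the
root edge `a`, the single-crossing products over the rim equal the mass of the walks
`a → b` crossing the rim of `H` exactly once. -/
theorem renewal_identity (Λ H : Finset HexVertex) (hH : H ⊆ Λ) (a b : Sym2 HexVertex)
    (ha : ∀ v ∈ a, v ∉ H) (hb : ∀ v ∈ b, v ∈ Λ → v ∈ H) :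
    ∑ᶠ w ∈ rim Λ H, Z (Λ \ H) a w * Z H w b
      = ∑ ω : HexMidEdgeSAW Λ a b,
          (if crossCount H ω = 1 then hexCriticalFugacity ^ ω.length else 0) := by
  sorry

/-- FLOATING RENEWAL (identity of the evidence note; provable now by summing
`renewal_identity`): for a finite family `𝓗` of regions (in the card: the nested half-discs
`H_r`, `r ∈ [r₁, 2r₁]`, about `b_δ`), the sum of the single-crossing products equals the mass of
walks `a → b` weighted by their NUMBER OF SINGLE-CROSSED RIMS `N_𝓗(ω)` — so
`Z_Λ(a → b) = (Σ_{H} Σ_{w} Z_{Λ∖H}(a → w) Z_H(w → b)) / E_{a→b}[N_𝓗]` exactly: the price of the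
point-to-arc conversion at the pinned flat piece is the (upper bound on the) mean renewal count,
not the single-crossing probability. -/
theorem floating_identity (Λ : Finset HexVertex) (a b : Sym2 HexVertex)
    (𝓗 : Finset (Finset HexVertex)) (h𝓗 : ∀ H ∈ 𝓗, H ⊆ Λ)
    (ha : ∀ H ∈ 𝓗, ∀ v ∈ a, v ∉ H) (hb : ∀ H ∈ 𝓗, ∀ v ∈ b, v ∈ Λ → v ∈ H) :
    ∑ H ∈ 𝓗, ∑ᶠ w ∈ rim Λ H, Z (Λ \ H) a w * Z H w b
      = ∑ ω : HexMidEdgeSAW Λ a b,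
          ((𝓗.filter (fun H => crossCount H ω = 1)).card : ℝ) * hexCriticalFugacity ^ ω.length := by
  sorry

/-- Consequence (trivial from `floating_identity`): an upper bound `N` on the
renewal count of every walk gives the lower bound `Σ_H Σ_w … ≤ N · Z_Λ(a → b)`; with the TRIVIAL
`N = |𝓗|` this is the fixed-radius pinch (loss `r^{-1/4}` at predicted exponents), with a
renewal-rarity bound `E[N_𝓗] ≤ C r^{1-κ_N}` the loss is `r^{-(1/4-κ_N)}`. -/
theorem floating_lower_bound (Λ : Finset HexVertex) (a b : Sym2 HexVertex)
    (𝓗 : Finset (Finset HexVertex)) (h𝓗 : ∀ H ∈ 𝓗, H ⊆ Λ)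
    (ha : ∀ H ∈ 𝓗, ∀ v ∈ a, v ∉ H) (hb : ∀ H ∈ 𝓗, ∀ v ∈ b, v ∈ Λ → v ∈ H)
    (N : ℕ) (hN : ∀ ω : HexMidEdgeSAW Λ a b, (𝓗.filter (fun H => crossCount H ω = 1)).card ≤ N) :
    ∑ H ∈ 𝓗, ∑ᶠ w ∈ rim Λ H, Z (Λ \ H) a w * Z H w b ≤ (N : ℝ) * Z Λ a b := by
  sorry

end FloatingRenewal

end

end Summit.CriticalPhenomena.SAWScalingLimit.Cruxes.MassRatio
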